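import Mathlib
import HarnessLib

/-!
# Markman 2025 — formula (3.1.2) and LEMMA 3.1.2 (the Hermitian form `H` of a `2n`-fold of Weil type:
# Hermitian, `SO₊(V_ℚ)_f`-invariant, signature `(n, n)`): the algebra of its proof AS PRINTED (v2 p. 22 L48 – p. 23 L33)

E. Markman: [M] *Cycles on abelian 2n-folds of Weil type from secant sheaves on abelian n-folds*,
arXiv:2502.03415 **v2**, bib `Markman2025SecantWeil` — UNREFEREED PREPRINT. «v2 p. N L m» = PyMuPDF line `m` of PDF
page `N` of the public arXiv PDF (sha256/16 `8155aa33870069b8`); read BY EYE at seat lit-w-markman g15 (pub-hsemireg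
LIT-W, 2026-08-23) on the 160-dpi renders `r_mar25_v2_p22_SOf_312.png` (sha256/16 `2c42910816087a70`) and
`r_mar25_v2_p23_lemma312.png` (`ef7974e52692495c`) in `HOME/lit/Markman-renders-litw-markman-g15/`.

## What is printed (verbatim, by eye)

* v2 p. 22 L21–26: «`SO₊(V_ℚ)_f` be the subgroup of `SO₊(V_ℚ)` of elements `g`, which commute with `f` and which
  restriction `g|_{W_i}` to each of the eigenspaces `W_i` of `f` satisfy `det(g|_{W_i}) = 1`, `i = 1, 2`. Let `σ` be
  the generator of `Gal(K/ℚ)`.»  v2 p. 22 L48–52: «Consider the `K`-valued bilinear form on `V_ℚ` given by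
  (3.1.2) `H(x, y) := d(x, y)_V + √−d(f(x), y)_V`.»
* LEMMA 3.1.2 (v2 p. 23 L3–6): «`H` is an `SO₊(V_ℚ)_f`-invariant Hermitian form on `V_ℚ` considered as a `K`-vector
  space, i.e., we have `H(x, y) = σ(H(y, x))` and `H(x, η_λ(y)) = λH(x, y)`, for `λ ∈ K`. The signature of `H` is
  `(n, n)`. The group `SO₊(V_ℚ)_f` is a finite index subgroup of the subgroup `SU(V_ℚ, H)` of `SL(V_ℚ)` leaving
  `H` invariant.»
* PROOF (v2 p. 23 L7–33): «The automorphism `f` is anti-self-dual with respect to the pairing (1.2.2),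
  `(f(x), y)_V = (x, −f(y))_V`, for all `x, y ∈ V_ℚ`, and `f² = −d𝟙_{V_ℚ}`, where `𝟙_{V_ℚ}` is the identity
  endomorphism of `V_ℚ`. So, `f̃ := (1/√d)f` is a complex structure and an isometry of `V_ℝ` and
  `(x, y)_V + i(f̃(x), y)` is a `ℂ`-valued Hermitian form on `V_ℝ`. Multiplying by `√d` we see that `H`, given in
  (3.1.2), is a `K`-valued Hermitian form on `V_ℚ`, considered as a `2n`-dimensional `K`-vector space. `H` is
  `SO₊(V_ℚ)_f`-invariant, since `f` centralizes `SO₊(V_ℚ)_f`. The signature of `H` is `(a, b)` if the `2n × 2n`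
  diagonal Gram matrix `G` (necessarily with rational entries) of the quadratic form `H(x, x)` with respect to some
  orthogonal `K`-basis `{v₁, …, v_{2n}}` of `V_ℚ` has `a` positive and `b` negative diagonal entries. The quadratic
  form depends only on the real part of `H`. Hence, `{v₁, …, v_{2n}, f(v₁), …, f(v_{2n})}` is an orthogonal `ℚ`-basis
  of `V_ℚ` with respect to the real part of `H` and the Gram matrix of the quadratic form is diagonal of the form
  `(G 0; 0 dG)`. Hence, if the signature of `H` is `(a, b)` then that of the latter is `(2a, 2b)`. On the other hand,
  the latter quadratic form is that of `d` times the bilinear pairing (1.2.2) on `V_ℚ`, which has signature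
  `(2n, 2n)`. Hence, `a = b = n`.»  (p. 23 L34–44, the finite-index part: «… Now `1 = det(g)` is equal to the
  determinant of `g` as an element of `GL(V_K)`, which is `det(M) det(σ(M))`. Thus, `det(M)` is a unit in the
  quadratic imaginary number field `K`. The statement follows, since the number of units is finite.»)

## What this file proves (kernel-checked algebra of the sentences above; NO named fact, nothing geometric)

MODEL. `F` a field (`ℚ`, or `ℝ`), `V` an `F`-vector space with a symmetric bilinear form `B = (•, •)_V`, an
endomorphism `f` that is anti-self-dual (`B (f x) y = −B x (f y)`) with `f ∘ f = −d·𝟙`; `K = F(√−d)` is Mathlib's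
`QuadraticAlgebra F (−d) 0` (`ω = √−d`, `ω² = −d`, `star` = `σ`), `H` of (3.1.2) is `H B f d x y := ⟨d·B x y, B (f x) y⟩`
(`= d(x, y)_V + √−d(f(x), y)_V`) and `η_λ(y) := (Re λ)·y + (Im λ)·f(y)` is the `K`-structure (`η_{√−d} = f`).
THEOREMS: `pairing_f_f` (`(f x, f y) = d(x, y)`), `eta_mul` (`η` is a `K`-action), `hermitian_symm`
(`H(x, y) = σ(H(y, x))`), `linear_right` (`H(x, η_λ y) = λH(x, y)`), `conjLinear_left` (`H(η_λ x, y) = σ(λ)H(x, y)`),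
`invariant` (an isometry commuting with `f` preserves `H`), `re_self`/`im_self` (`H(x, x) = d(x, x)_V` is «real»),
`ftilde_sq`/`ftilde_isometry` (`f̃ = t⁻¹f` with `t² = d`: `f̃² = −𝟙`, `(f̃x, f̃y) = (x, y)`), `gram_block` (for an
`H`-orthogonal pair `v, w` all `Re H` cross terms among `v, w, f v, f w` vanish, `Re H(v, f v) = 0`, and
`Re H(f v, f v) = d·Re H(v, v)` — the `(G 0; 0 dG)` display), `posCount_double`/`negCount_double` (over an ordered
field with `d > 0` the diagonal `(G, dG)` has twice as many positive, resp. negative, entries as `G` — «`(2a, 2b)`»),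
`half_signature` (`2a = 2n ⇒ a = n`), `det_isUnit_of_norm_one` («`det(M) det(σ(M)) = 1` ⇒ `det M` is a unit»).
READING PRECISION P-3.1.2 (lit-w-markman g15, ×1; not an erratum, nothing downstream moves): with `f̃ = f/√d` one
has `√−d(f(x), y)_V = i·d·(f̃(x), y)_V`, so `H = d·((x, y)_V + i(f̃(x), y)_V)` — the printed «Multiplying by `√d`»
should read «by `d`» (`√d` times the `ℂ`-valued form is `√d(x, y)_V + i(f(x), y)_V ≠ H` unless `d = 1`); either
positive multiple is Hermitian, so the conclusion stands (`toI_H` below states the factor `d`; `precision_P312` the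
inequality of real parts when `d ≠ 1`).  BY VALUE / NOT formalised: `V_ℚ = H¹(X, ℚ) ⊕ H¹(X̂, ℚ)` and the pairing
(1.2.2) with its signature `(2n, 2n)`, the eigenspaces `W_i`, `SO₊`, `SU(V_ℚ, H)`, the existence of an orthogonal
`K`-basis, Sylvester's law (signature well defined), finiteness of the unit group of an imaginary quadratic field.
Bookkeeping for the pub-hsemireg LIT-W table row M-Mk1 (Weil type, `K = ℚ(√−d)`, signature `(n, n)`, the input of
LEMMA 3.1.3 = `ProductWeilTypeDiscriminant.lean`) and of `WeilPeriodDomainDimension.lean` (which takes Lemma 3.1.2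
by value); it says nothing about the Hodge conjecture and re-proves no theorem of [M]. Sibling, different model
(alternating `E`, van Geemen 6.9): `Literature/Geometry/Kaehler/ComplexTorusWeilTypeHermitianForm.lean`.
-/

namespace Literature.AlgebraicGeometry.Markman2025

namespace HermitianForm312

open QuadraticAlgebra

variable {F : Type*} [Field F] {V : Type*} [AddCommGroup V] [Module F V]

/-- `K = F(√−d)` as Mathlib's quadratic algebra: `⟨p, q⟩ = p + q√−d`, `ω = ⟨0, 1⟩ = √−d`, `ω² = −d`, `star ⟨p, q⟩ =
⟨p, −q⟩` is `σ`. [cite: Markman2025SecantWeil, §3.1, v2 p. 22 L23–24] -/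
abbrev Kd (F : Type*) [Field F] (d : F) : Type _ := QuadraticAlgebra F (-d) 0

/-- **(3.1.2)** «`H(x, y) := d(x, y)_V + √−d(f(x), y)_V`», as the pair (real part, coefficient of `√−d`).
[cite: Markman2025SecantWeil, (3.1.2), v2 p. 22 L48–52] -/
def H (B : V →ₗ[F] V →ₗ[F] F) (f : V →ₗ[F] V) (d : F) (x y : V) : Kd F d := ⟨d * B x y, B (f x) y⟩

/-- The `K`-vector-space structure `η` on `V_ℚ` («`V_ℚ` considered as a `K`-vector space»): `λ = p + q√−d` acts by
`η_λ = p·𝟙 + q·f` (so `η_{√−d} = f`). [cite: Markman2025SecantWeil, Lemma 3.1.2, v2 p. 23 L3–5] -/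
def eta (f : V →ₗ[F] V) {d : F} (c : Kd F d) (y : V) : V := c.re • y + c.im • f y

/-- Real part of (3.1.2): `Re H(x, y) = d(x, y)_V`. [cite: Markman2025SecantWeil, (3.1.2), v2 p. 22 L48–52] -/
@[simp] theorem H_re (B : V →ₗ[F] V →ₗ[F] F) (f : V →ₗ[F] V) (d : F) (x y : V) :
    (H B f d x y).re = d * B x y := rfl

/-- Coefficient of `√−d` in (3.1.2): `(f(x), y)_V`. [cite: Markman2025SecantWeil, (3.1.2), v2 p. 22 L48–52] -/
@[simp] theorem H_im (B : V →ₗ[F] V →ₗ[F] F) (f : V →ₗ[F] V) (d : F) (x y : V) :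
    (H B f d x y).im = B (f x) y := rfl

/-- Unfolding of the `K`-structure: `η_{p + q√−d}(y) = p·y + q·f(y)`. [cite: Markman2025SecantWeil, Lemma 3.1.2, v2 p. 23 L3–5] -/
theorem eta_def (f : V →ₗ[F] V) {d : F} (c : Kd F d) (y : V) : eta f c y = c.re • y + c.im • f y := rfl

/-- `η_{√−d} = f`. [cite: Markman2025SecantWeil, Lemma 3.1.2, v2 p. 23 L3–5] -/
theorem eta_omega (f : V →ₗ[F] V) (d : F) (y : V) : eta f (⟨0, 1⟩ : Kd F d) y = f y := by
  simp [eta_def]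

variable (B : V →ₗ[F] V →ₗ[F] F) (f : V →ₗ[F] V) (d : F)

/-- «`(f(x), y)_V = (x, −f(y))_V` … and `f² = −d𝟙`» ⇒ `(f x, f y)_V = d(x, y)_V` (`f` is a similarity of multiplier `d`).
[cite: Markman2025SecantWeil, Lemma 3.1.2 (proof), v2 p. 23 L7–9] -/
theorem pairing_f_f (hf : ∀ x y, B (f x) y = -B x (f y)) (hf2 : ∀ x, f (f x) = -(d • x)) (x y : V) :
    B (f x) (f y) = d * B x y := by
  rw [hf, hf2]; simp

/-- `η` is a `K`-action: `η_λ(η_μ(y)) = η_{λμ}(y)` (uses `f² = −d𝟙`), i.e. «`V_ℚ` considered as a `K`-vector space».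
[cite: Markman2025SecantWeil, Lemma 3.1.2, v2 p. 23 L3–5] -/
theorem eta_mul (hf2 : ∀ x, f (f x) = -(d • x)) (c c' : Kd F d) (y : V) :
    eta f c (eta f c' y) = eta f (c * c') y := by
  simp only [eta_def, map_add, map_smul, hf2, re_mul, im_mul, smul_add, smul_neg, smul_smul, zero_mul, add_zero]
  module

/-- «we have `H(x, y) = σ(H(y, x))`» (`σ = star`). [cite: Markman2025SecantWeil, Lemma 3.1.2, v2 p. 23 L4] -/
theorem hermitian_symm (hB : ∀ x y, B x y = B y x) (hf : ∀ x y, B (f x) y = -B x (f y)) (x y : V) :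
    H B f d x y = star (H B f d y x) := by
  ext
  · simp [hB x y]
  · simp only [H_im, im_star]
    rw [hf y x, hB y (f x), neg_neg]

/-- «and `H(x, η_λ(y)) = λH(x, y)`, for `λ ∈ K`» (`K`-linear in the second variable).
[cite: Markman2025SecantWeil, Lemma 3.1.2, v2 p. 23 L4–5] -/
theorem linear_right (hf : ∀ x y, B (f x) y = -B x (f y)) (hf2 : ∀ x, f (f x) = -(d • x)) (c : Kd F d) (x y : V) :
    H B f d x (eta f c y) = c * H B f d x y := by
  have h1 : B x (f y) = -B (f x) y := by rw [hf]; simp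
  have h2 := pairing_f_f B f d hf hf2 x y
  ext
  · simp only [H_re, H_im, eta_def, map_add, map_smul, smul_eq_mul, re_mul, h1]; ring
  · simp only [H_re, H_im, eta_def, map_add, map_smul, smul_eq_mul, im_mul, h2]; ring

/-- Consequently `H(η_λ(x), y) = σ(λ)H(x, y)` (conjugate-linear in the first variable).
[cite: Markman2025SecantWeil, Lemma 3.1.2, v2 p. 23 L3–5] -/
theorem conjLinear_left (hf2 : ∀ x, f (f x) = -(d • x)) (c : Kd F d) (x y : V) :
    H B f d (eta f c x) y = star c * H B f d x y := by
  ext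
  · simp only [H_re, H_im, eta_def, map_add, map_smul, LinearMap.add_apply, LinearMap.smul_apply, smul_eq_mul,
      re_mul, re_star, im_star]; ring
  · simp only [H_re, H_im, eta_def, map_add, map_smul, LinearMap.add_apply, LinearMap.smul_apply, smul_eq_mul,
      im_mul, re_star, im_star, hf2, map_neg, LinearMap.neg_apply]; ring

/-- «`H` is `SO₊(V_ℚ)_f`-invariant, since `f` centralizes `SO₊(V_ℚ)_f`»: any isometry `g` of `(•, •)_V` commuting with
`f` preserves `H`. [cite: Markman2025SecantWeil, Lemma 3.1.2 (proof), v2 p. 23 L17] -/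
theorem invariant (g : V →ₗ[F] V) (hg : ∀ x y, B (g x) (g y) = B x y) (hgf : ∀ x, g (f x) = f (g x)) (x y : V) :
    H B f d (g x) (g y) = H B f d x y := by
  ext
  · simp [hg]
  · simp only [H_im]; rw [← hgf, hg]

/-- «The quadratic form depends only on the real part of `H`» and «the latter quadratic form is that of `d` times the
bilinear pairing (1.2.2)»: `Re H(x, x) = d(x, x)_V`. [cite: Markman2025SecantWeil, Lemma 3.1.2 (proof), v2 p. 23 L20–32] -/
theorem re_self (x : V) : (H B f d x x).re = d * B x x := rfl

/-- … and `Im H(x, x) = 0` ((f x, x) = −(x, f x) = −(f x, x); characteristic `≠ 2`).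
[cite: Markman2025SecantWeil, Lemma 3.1.2 (proof), v2 p. 23 L20–21] -/
theorem im_self (hB : ∀ x y, B x y = B y x) (hf : ∀ x y, B (f x) y = -B x (f y)) (h2 : (2 : F) ≠ 0) (x : V) :
    (H B f d x x).im = 0 := by
  have h : B (f x) x = -B (f x) x :=
    calc B (f x) x = -B x (f x) := hf x x
      _ = -B (f x) x := by rw [hB x (f x)]
  have : (2 : F) * B (f x) x = 0 := by linear_combination h
  simpa [h2] using this

/-- «`f̃ := (1/√d)f` is a complex structure … of `V_ℝ`»: with `t² = d ≠ 0` (`t = √d`), `f̃ := t⁻¹f` has `f̃² = −𝟙`.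
[cite: Markman2025SecantWeil, Lemma 3.1.2 (proof), v2 p. 23 L9–12] -/
theorem ftilde_sq (hf2 : ∀ x, f (f x) = -(d • x)) (t : F) (ht : t * t = d) (hd : d ≠ 0) (x : V) :
    (t⁻¹ • f) ((t⁻¹ • f) x) = -x := by
  have ht0 : t ≠ 0 := by rintro rfl; exact hd (by simpa using ht.symm)
  simp only [LinearMap.smul_apply, map_smul, hf2, smul_neg, smul_smul]
  rw [← ht, show t⁻¹ * (t⁻¹ * (t * t)) = 1 by field_simp, one_smul]

/-- «… and an isometry of `V_ℝ`»: `(f̃x, f̃y)_V = (x, y)_V`. [cite: Markman2025SecantWeil, Lemma 3.1.2 (proof), v2 p. 23 L12] -/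
theorem ftilde_isometry (hf : ∀ x y, B (f x) y = -B x (f y)) (hf2 : ∀ x, f (f x) = -(d • x)) (t : F)
    (ht : t * t = d) (hd : d ≠ 0) (x y : V) : B ((t⁻¹ • f) x) ((t⁻¹ • f) y) = B x y := by
  have ht0 : t ≠ 0 := by rintro rfl; exact hd (by simpa using ht.symm)
  simp only [LinearMap.smul_apply, map_smul, LinearMap.smul_apply, smul_eq_mul, pairing_f_f B f d hf hf2]
  rw [← ht]; field_simp

/-- Passage `K = F(√−d) → F(i)`, `p + q√−d ↦ (p, q·t)` with `t = √d` (so `√−d = i·t`): the pair (real part,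
coefficient of `i`). [cite: Markman2025SecantWeil, Lemma 3.1.2 (proof), v2 p. 23 L12–16] -/
def toI (t : F) (c : Kd F d) : F × F := (c.re, c.im * t)

/-- READING PRECISION P-3.1.2, the identity: `H(x, y) = d·((x, y)_V + i(f̃(x), y)_V)` — in `F(i)`-coordinates
`H(x, y) ↦ (d(x, y)_V, d(f̃x, y)_V)`. [cite: Markman2025SecantWeil, Lemma 3.1.2 (proof), v2 p. 23 L12–16] -/
theorem toI_H (t : F) (ht : t * t = d) (hd : d ≠ 0) (x y : V) :
    toI d t (H B f d x y) = (d * B x y, d * B ((t⁻¹ • f) x) y) := by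
  have ht0 : t ≠ 0 := by rintro rfl; exact hd (by simpa using ht.symm)
  simp only [toI, H_re, H_im, LinearMap.smul_apply, map_smul, LinearMap.smul_apply, smul_eq_mul]
  rw [← ht]; field_simp

/-- READING PRECISION P-3.1.2, the inequality: `√d` times the `ℂ`-valued form, `(t(x, y)_V, t(f̃x, y)_V)`, has real
part `t(x, y)_V ≠ d(x, y)_V = Re H(x, y)` as soon as `d ≠ 1` and `(x, y)_V ≠ 0` (with `t² = d ≠ 0`); the printed
«Multiplying by `√d`» is to be read «by `d`». [cite: Markman2025SecantWeil, Lemma 3.1.2 (proof), v2 p. 23 L13–16] -/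
theorem precision_P312 (t : F) (ht : t * t = d) (hd : d ≠ 0) (hd1 : d ≠ 1) (x y : V) (hxy : B x y ≠ 0) :
    t * B x y ≠ (toI d t (H B f d x y)).1 := by
  intro h
  simp only [toI, H_re] at h
  have htd : t = d := by simpa [hxy] using mul_right_cancel₀ hxy h
  subst htd
  rcases mul_eq_zero.mp (show t * (t - 1) = 0 by linear_combination ht) with h0 | h1
  · exact hd h0
  · exact hd1 (by linear_combination h1)

/-- The `(G 0; 0 dG)` display: for `v, w` with `H(v, w) = 0` («orthogonal `K`-basis») and `d ≠ 0`, all `Re H` cross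
terms among `v, w, f v, f w` vanish; moreover `Re H(v, f v) = 0` and `Re H(f v, f v) = d·Re H(v, v)` (characteristic
`≠ 2`). [cite: Markman2025SecantWeil, Lemma 3.1.2 (proof), v2 p. 23 L21–30] -/
theorem gram_block (hB : ∀ x y, B x y = B y x) (hf : ∀ x y, B (f x) y = -B x (f y))
    (hf2 : ∀ x, f (f x) = -(d • x)) (h2 : (2 : F) ≠ 0) (hd : d ≠ 0) (v w : V) (hvw : H B f d v w = 0) :
    (H B f d v (f w)).re = 0 ∧ (H B f d (f v) w).re = 0 ∧ (H B f d (f v) (f w)).re = 0 ∧ (H B f d v w).re = 0 ∧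
      (H B f d v (f v)).re = 0 ∧ (H B f d (f v) (f v)).re = d * (H B f d v v).re := by
  have hre : d * B v w = 0 := by simpa using congrArg QuadraticAlgebra.re hvw
  have him : B (f v) w = 0 := by simpa using congrArg QuadraticAlgebra.im hvw
  have hvw' : B v w = 0 := by simpa [hd] using hre
  have h1 : B v (f w) = -B (f v) w := by rw [hf]; simp
  have hvfv : B v (f v) = 0 := by
    have h : B (f v) v = -B (f v) v :=
      calc B (f v) v = -B v (f v) := hf v v
        _ = -B (f v) v := by rw [hB v (f v)]
    have : (2 : F) * B (f v) v = 0 := by linear_combination h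
    rw [hB]; simpa [h2] using this
  refine ⟨?_, ?_, ?_, ?_, ?_, ?_⟩
  · simp [h1, him]
  · simp [him]
  · simp [pairing_f_f B f d hf hf2, hvw']
  · simp [hvw']
  · simp [hvfv]
  · simp [pairing_f_f B f d hf hf2]

end HermitianForm312

namespace HermitianForm312

/-! ### The signature count: `(a, b) ↦ (2a, 2b)` and `2a = 2n ⇒ a = n` -/

variable {F : Type*} [Field F] [LinearOrder F] [IsStrictOrderedRing F] {ι : Type*} [Fintype ι]

/-- Number of positive, resp. negative, entries of a diagonal `v`. [folklore] -/
def posCount (v : ι → F) : ℕ := ∑ i, if 0 < v i then 1 else 0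

/-- See `posCount`. [folklore] -/
def negCount (v : ι → F) : ℕ := ∑ i, if v i < 0 then 1 else 0

/-- «Hence, if the signature of `H` is `(a, b)` then that of the latter is `(2a, 2b)`», positive entries: for
`d > 0` the diagonal `(G, dG)` on `ι ⊕ ι` has `2a` positive entries if `G` has `a`.
[cite: Markman2025SecantWeil, Lemma 3.1.2 (proof), v2 p. 23 L30–31] -/
theorem posCount_double (d : F) (hd : 0 < d) (G : ι → F) :
    posCount (Sum.elim G (fun i => d * G i)) = 2 * posCount G := by
  simp only [posCount, Fintype.sum_sum_type, Sum.elim_inl, Sum.elim_inr, mul_pos_iff_of_pos_left hd]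
  ring

/-- Same for negative entries: `(G, dG)` has `2b` negative entries if `G` has `b` (`d > 0`).
[cite: Markman2025SecantWeil, Lemma 3.1.2 (proof), v2 p. 23 L30–31] -/
theorem negCount_double (d : F) (hd : 0 < d) (G : ι → F) :
    negCount (Sum.elim G (fun i => d * G i)) = 2 * negCount G := by
  have key : ∀ g : F, d * g < 0 ↔ g < 0 := fun g => by
    rw [← neg_pos, ← mul_neg, mul_pos_iff_of_pos_left hd, neg_pos]
  simp only [negCount, Fintype.sum_sum_type, Sum.elim_inl, Sum.elim_inr, key]
  ring

/-- «the latter quadratic form is that of `d` times the bilinear pairing (1.2.2) on `V_ℚ`, which has signature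
`(2n, 2n)`»: scaling a diagonal by `d > 0` keeps the counts. [cite: Markman2025SecantWeil, Lemma 3.1.2 (proof), v2 p. 23 L31–32] -/
theorem posCount_smul (d : F) (hd : 0 < d) (G : ι → F) :
    posCount (fun i => d * G i) = posCount G ∧ negCount (fun i => d * G i) = negCount G := by
  have key : ∀ g : F, d * g < 0 ↔ g < 0 := fun g => by
    rw [← neg_pos, ← mul_neg, mul_pos_iff_of_pos_left hd, neg_pos]
  exact ⟨by simp only [posCount, mul_pos_iff_of_pos_left hd], by simp only [negCount, key]⟩

/-- «Hence, `a = b = n`.»: `2a = 2n` and `2b = 2n` give `a = n` and `b = n`.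
[cite: Markman2025SecantWeil, Lemma 3.1.2 (proof), v2 p. 23 L32–33] -/
theorem half_signature (a b n : ℕ) (ha : 2 * a = 2 * n) (hb : 2 * b = 2 * n) : a = n ∧ b = n := by omega

/-- The finite-index tail, its one algebraic step: «`1 = det(g)` … is `det(M) det(σ(M))`. Thus, `det(M)` is a unit»
— in `K = F(√−d)`, `m·σ(m) = 1 ⇒ m` is a unit (finiteness of the unit group of the ring of integers of an imaginary
quadratic field is taken BY VALUE). [cite: Markman2025SecantWeil, Lemma 3.1.2 (proof), v2 p. 23 L41–44] -/
theorem det_isUnit_of_norm_one {F : Type*} [Field F] {d : F} (m : Kd F d) (h : m * star m = 1) : IsUnit m :=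
  IsUnit.of_mul_eq_one (star m) h

end HermitianForm312

end Literature.AlgebraicGeometry.Markman2025
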